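import Summits.BirchSwinnertonDyer.Rank1Residual.GaloisImage.CyclotomicGroupRingDerivativeGlue
import Summits.BirchSwinnertonDyer.Rank1Residual.GaloisImage.KatoZetaValueConjugation
import HarnessLib

/-!
# The VALUE WITNESS `s` at a general tame level: from the group-ring comparison (PK-4b-C's OUT)
# to PK-5 (ii)'s `hval` premise in value form (T-PK-PAR §5 / T-PK6-D58 (S3)'s IN)
# (cell `b2b-bsdres`, team n1011, ROUTE-1 PORT anatomy (P-KIM); ROW T-PK6-VAL, seat p02 GEN 13;
# p13 `skel/T-PORT-1-PKIM.md` v0.4 item (11), r1 R1-72 (B) / D-58-1)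

HONEST FRAMING (cell `b2b-bsdres`, run/shared/lean/b2b/bsd-rank1-residual/, verbatim in every
file): the goal of the cell is to DELETE the COMBINATION-SHAPED residual classes of the
Birch–Swinnerton-Dyer formula for ALL analytic-rank `≤ 1` elliptic curves over `ℚ` — "full BSD
formula for every rank `≤ 1` curve in class `C`" assembled STRICTLY from published theorems — so
that the rank-`≤ 1` remainder becomes exactly the CONSTRUCTION-SHAPED classes, which are TYPED
(missing-input `Prop`s), NOT attempted. This is not "finishing BSD". Team n1011 (N10/N11; ROUTE 1,
the PORT anatomy (P-KIM) of class X4 ∧ `p = 3`): research route on CONSTRUCTION-SHAPED classes;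
prove what is provable now; no claim beyond stated classes; census output = EVIDENCE, never a
Literature fact; RESIDUAL-MAP marks UNCHANGED; nothing is booked by this file. TOOL THEOREMS ONLY:
no definition, no named fact, no instance, no `sorry`.

## What

At a tame Kolyvagin level `n` (square-free, `p ∤ n`; `G = (ℤ/n)ˣ` acting on `ℚ(ζ_n)` by the `σ_g` of
`Kato2004.EulerSystemValues`), the PORT's value law needs ONE scalar `s ∈ ℤ_p` with
`p^t • (1 ⊗ 𝔇^{field}(x + σ₋₁ x)) − s ⊗ 1 ∈ p^{k+1} · L_int(n)`                                  (hval)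
(`x` = Kato's `x_{0,r}`, `𝔇^{field} = ∏_i Σ_{j<N_i} j σ_{b_i}^j`, `L_int = cycIntLattice`) — the premise
of PK-5 (ii) for the SYMMETRISED derivative class (T-PK-PAR
`KatoParity.apply_localization_add_self_eq_toZModPow_of_zetaBody_deriv`, p13; T-PK6-D58 (S3), p11) —
and the reading `s ≡ w · p^t · δ̃_n (mod p^{k+1})`, `w` a unit.  PK-4b-C (p15: C3
`GroupRingEulerFactorComparison` + C4b) delivers a GROUP-RING statement: for the avatar `X ∈ ℚ[G]` of
`x` (T-PKEV E-D: `x = Σ_g X_g • σ_g ζ_n`), its scaled plus-projection `X⁺ = λ • (1 + δ₋₁)·X` and a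
`p`-integral structure `Θ` of the twisted Mazur–Tate pull-back, `∏_i D_i · (X⁺ − Θ) ∈ p^{k+1}·ℤ_p[G]`
— NO integrality of `X` (Kato's `ZetaBody` carries none).  This file is the connector, by name:
§1 group-ring glue (`X · Σ_g δ_g = aug(X) • Σ_g δ_g`; ★ the TWIST of PK-3's identity
`Θ̄·∏D = c·∏Nrm ⟹ (Θ·V)̄·∏D = (c · aug V̄)·∏Nrm` for ANY integral `V` — the cusp / `A`-depletion /
`(1 + δ₋₁)` / `δ_{u⁻¹}` factors ride as one `V`; the membership form ⟹ T-PKEV E-C's `hXY`; `Fin`/`range`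
spellings and the reindexing `n.primeFactors ↔` places); §2 the symmetrised avatar
`Σ_g (λ • (1 + δ₋₁)·X)_g • σ_g ζ_n = λ • (x + σ₋₁ x)`; §3 ★★ (hval) with `s := p^t · u⁻¹ · c̃ · μ(n)`
(`u ∈ ℤ_pˣ` the scalar `λ`, `c̃` a lift of `c`) from E-C ★★
`GroupRingEval.exists_mem_cycIntLattice_one_tmul_deriv_sub_tmul_eq_pow_smul_of_comparison`; §4 the
unit reading: `(−1)^{ν(n)} μ(n) = 1`, so PK-3's scalar `c = (−1)^{ν(n)} δ̃_n · a` (`a = aug V̄` a unit)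
gives `s ≡ (ū⁻¹ a) · p^t · δ̃_n`.  HONEST LIMITS: pure algebra over T-PKEV E-A/E-B/E-C/E-E; nothing
about `ZetaBody`, classes, `exp*`, Euler or Kolyvagin systems is used or proved; the comparison (PK-4b-C)
and PK-3's identity are HYPOTHESES here; closes nothing; books nothing; 0 defs / 0 facts.

References: C.-H. Kim, AJM 148 (2026) = arXiv:2203.12159, proof of Thm. 3.13 (v3 pp. 26–28)
[Kim2022StructureSelmer]; C.-H. Kim, K. Nakamura, JNT 210 (2020) Prop. 3.5, Rem. 3.6 [KimNakamura2020];
K. Rubin, *Euler Systems* (2000) Def. 4.4.1, §9.6 [Rubin2000]; design `cells/n1011/ROUTE-1.md`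
§56.3 R1-72 (B), §58.2 D-58-1 (r1); `cells/n1011/skel/T-PORT-1-PKIM.md` v0.4 (11) (p13);
`HOME/b2b-bsdres-n1011-p15/g9/pk4/PK4b-C4-DESIGN.md` (p15).
-/

noncomputable section

open scoped BigOperators TensorProduct
open Finset

namespace Summit.BirchSwinnertonDyer.Rank1Residual.GaloisImage

namespace GroupRingEval

open Literature.NumberTheory.EllipticCurves.Kato2004.EulerSystemValues

/-! ### §1 Group-ring glue -/
section Generic

variable {R : Type*} [CommRing R] {G : Type*} [CommGroup G] [Fintype G]

/-- **`X · N_G = aug(X) · N_G`** for the full norm element `N_G = Σ_g δ_g` of a finite commutative group.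
[folklore] -/
theorem mul_sum_single_one_eq_sum_coeff_smul (X : MonoidAlgebra R G) :
    X * ∑ g : G, MonoidAlgebra.single g (1 : R) =
      (∑ g : G, X.coeff g) • ∑ g : G, MonoidAlgebra.single g (1 : R) := by
  classical
  refine MonoidAlgebra.coeff_injective (Finsupp.ext fun h => ?_)
  rw [Finset.mul_sum, MonoidAlgebra.coeff_sum, MonoidAlgebra.coeff_smul_apply,
    MonoidAlgebra.coeff_sum, Finsupp.coe_finsetSum, Finsupp.coe_finsetSum, Finset.sum_apply,
    Finset.sum_apply]
  simp_rw [MonoidAlgebra.coeff_mul_single_apply, mul_one, MonoidAlgebra.coeff_single]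
  have h2 : ∑ g : G, (Finsupp.single g (1 : R)) h = 1 := by
    rw [Finset.sum_eq_single_of_mem h (Finset.mem_univ h)
      (fun g _ hne => by rw [Finsupp.single_apply, if_neg hne]), Finsupp.single_eq_same]
  rw [h2, smul_eq_mul, mul_one]
  exact Fintype.sum_equiv ((Equiv.inv G).trans (Equiv.mulLeft h)) _ _ fun g => by simp

omit [Fintype G] in
/-- The `Fin`-indexed derivative (`a j = j`) / norm (`a j = 1`) element (PK-3 / T-PKEV E-C spelling)
is the `range`-indexed one (PK-4b-C3's spelling `D_i = Σ_{j ∈ range ν_i} j·δ_{b_i^j}`). [folklore] -/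
theorem sum_fin_single_pow_eq_sum_range (b : G) (N : ℕ) (a : ℕ → R) :
    ∑ j : Fin N, MonoidAlgebra.single (b ^ (j : ℕ)) (a j) =
      ∑ j ∈ Finset.range N, MonoidAlgebra.single (b ^ j) (a j) :=
  Fin.sum_univ_eq_sum_range (fun j => MonoidAlgebra.single (b ^ j) (a j)) N

omit [Fintype G] in
/-- **Reindexing PK-3's products by THEOREM D's places** (`ℓ : n.primeFactors`, lengths `ℓ − 1` ↔ a
level `d` of places with units `b_q`, lengths `N_q`): along a bijection `e : d ≃ β` matching units (`hb`)
and lengths (`hN`) the products `∏ Σ_{j<·} a(j)·δ_{(·)^j}` agree (`a j = j` / `a j = 1`). [folklore] -/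
theorem prod_sum_fin_single_pow_eq_of_equiv {α β : Type*} [Fintype β] (d : Finset α) (e : d ≃ β)
    (σ : β → G) (L : β → ℕ) (b : α → G) (N : α → ℕ) (a : ℕ → R)
    (hb : ∀ q : d, b q = σ (e q)) (hN : ∀ q : d, N q = L (e q)) :
    ∏ y : β, ∑ j : Fin (L y), MonoidAlgebra.single (σ y ^ (j : ℕ)) (a j) =
      ∏ q ∈ d, ∑ j : Fin (N q), MonoidAlgebra.single (b q ^ (j : ℕ)) (a j) := by
  rw [← Finset.prod_coe_sort d, ← Fintype.prod_equiv e
    (fun q : d => ∑ j : Fin (N q), MonoidAlgebra.single (b q ^ (j : ℕ)) (a j)) _ fun q => ?_]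
  rw [sum_fin_single_pow_eq_sum_range, sum_fin_single_pow_eq_sum_range, hb q, hN q]

end Generic

variable (p : ℕ) [Fact p.Prime] (n : ℕ) [NeZero n]

/-- **★ TWIST of PK-3's identity by an integral group-ring factor.**  If `Θ̄·∏_i D_i = c·∏_i Nrm_i`
in `(ℤ/p^K)[(ℤ/n)ˣ]` (PK-3 `MazurTateDerivative.mapRingHom_padicLift_mul_prod_deriv_eq_kuriharaNumber_smul`)
and `∏_i Nrm_i = Σ_g δ_g` (T-PKEV E-A `prod_norm_eq_sum_single`), then for EVERY `V ∈ ℤ_p[(ℤ/n)ˣ]`: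
`(Θ·V)̄·∏_i D_i = (c · aug V̄)·∏_i Nrm_i` (commutative group ring; `V̄·Σ_g δ_g = aug(V̄)·Σ_g δ_g`) —
the cusp element, the `A`-depletion Euler factors, `1 + δ₋₁` and `δ_{u⁻¹}` of PK-4b-C's `B` ride as ONE
such `V`. [cite: KimNakamura2020, Prop. 3.5 and Rem. 3.6 (arXiv v2 pp. 8–9)] -/
theorem mapRingHom_mul_mul_prod_deriv_eq_smul {ι : Type*} (d : Finset ι) (b : ι → (ZMod n)ˣ)
    (N : ι → ℕ) (Θ V : MonoidAlgebra ℤ_[p] (ZMod n)ˣ) (K : ℕ) (c : ZMod (p ^ K))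
    (hD : MonoidAlgebra.mapRingHom (ZMod n)ˣ (PadicInt.toZModPow K) Θ *
        ∏ i ∈ d, ∑ j : Fin (N i), MonoidAlgebra.single (b i ^ (j : ℕ)) ((j : ℕ) : ZMod (p ^ K)) =
      c • ∏ i ∈ d, ∑ j : Fin (N i), MonoidAlgebra.single (b i ^ (j : ℕ)) (1 : ZMod (p ^ K)))
    (hnorm : ∏ i ∈ d, ∑ j : Fin (N i), MonoidAlgebra.single (b i ^ (j : ℕ)) (1 : ℤ_[p]) =
      ∑ g : (ZMod n)ˣ, MonoidAlgebra.single g 1) :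
    MonoidAlgebra.mapRingHom (ZMod n)ˣ (PadicInt.toZModPow K) (Θ * V) *
        ∏ i ∈ d, ∑ j : Fin (N i), MonoidAlgebra.single (b i ^ (j : ℕ)) ((j : ℕ) : ZMod (p ^ K)) =
      (c * ∑ g : (ZMod n)ˣ, (MonoidAlgebra.mapRingHom (ZMod n)ˣ (PadicInt.toZModPow K) V).coeff g) •
        ∏ i ∈ d, ∑ j : Fin (N i), MonoidAlgebra.single (b i ^ (j : ℕ)) (1 : ZMod (p ^ K)) := by
  -- the norm elements reduce to the full norm element with `ℤ/p^K`-coefficients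
  have hnormK : ∏ i ∈ d, ∑ j : Fin (N i), MonoidAlgebra.single (b i ^ (j : ℕ)) (1 : ZMod (p ^ K)) =
      ∑ g : (ZMod n)ˣ, MonoidAlgebra.single g 1 := by
    have h := congrArg (MonoidAlgebra.mapRingHom (ZMod n)ˣ (PadicInt.toZModPow K)) hnorm
    rw [mapRingHom_prod_sum_single_pow, map_sum] at h
    simp_rw [map_one, MonoidAlgebra.mapRingHom_single, map_one] at h
    exact h
  rw [map_mul, mul_comm (MonoidAlgebra.mapRingHom _ _ Θ), mul_assoc, hD, mul_smul_comm, hnormK,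
    mul_sum_single_one_eq_sum_coeff_smul, smul_smul, mul_comm]

omit [NeZero n] in
/-- **The membership form of the comparison ⟹ T-PKEV E-C's `hXY`.**  PK-4b-C3's integral reading
(`EulerFactorComparison.sum_mem_map_of_images`) concludes that `∏_i D_i · (X⁺ − Θ)` lies in the IMAGE
of the ideal `p^K · ℤ_p[(ℤ/n)ˣ]` in `ℚ_p[(ℤ/n)ˣ]`; this is E-C's comparison
`X⁺·∏D = (Θ·∏D)^ℚ + p^K • W^ℚ` for some integral `W`. [folklore] -/
theorem exists_comparison_of_mem_map_span {ι : Type*} (d : Finset ι) (b : ι → (ZMod n)ˣ)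
    (N : ι → ℕ) (Xp : MonoidAlgebra ℚ (ZMod n)ˣ) (Θ : MonoidAlgebra ℤ_[p] (ZMod n)ˣ) (K : ℕ)
    (h : (∏ i ∈ d, ∑ j : Fin (N i), MonoidAlgebra.single (b i ^ (j : ℕ)) ((j : ℕ) : ℚ_[p])) *
        (MonoidAlgebra.mapRingHom (ZMod n)ˣ (algebraMap ℚ ℚ_[p]) Xp -
          MonoidAlgebra.mapRingHom (ZMod n)ˣ (PadicInt.Coe.ringHom (p := p)) Θ) ∈
      (Ideal.span {((p : MonoidAlgebra ℤ_[p] (ZMod n)ˣ)) ^ K}).toAddSubmonoid.map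
        (MonoidAlgebra.mapRingHom (ZMod n)ˣ (PadicInt.Coe.ringHom (p := p)) :
          MonoidAlgebra ℤ_[p] (ZMod n)ˣ →+ MonoidAlgebra ℚ_[p] (ZMod n)ˣ)) :
    ∃ W : MonoidAlgebra ℤ_[p] (ZMod n)ˣ,
      MonoidAlgebra.mapRingHom (ZMod n)ˣ (algebraMap ℚ ℚ_[p]) Xp *
          ∏ i ∈ d, ∑ j : Fin (N i), MonoidAlgebra.single (b i ^ (j : ℕ)) ((j : ℕ) : ℚ_[p]) =
        MonoidAlgebra.mapRingHom (ZMod n)ˣ (PadicInt.Coe.ringHom (p := p))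
            (Θ * ∏ i ∈ d, ∑ j : Fin (N i), MonoidAlgebra.single (b i ^ (j : ℕ)) ((j : ℕ) : ℤ_[p])) +
          ((p : ℚ_[p]) ^ K) • MonoidAlgebra.mapRingHom (ZMod n)ˣ (PadicInt.Coe.ringHom (p := p)) W := by
  obtain ⟨a, ha, hφa⟩ := h
  obtain ⟨W, hW⟩ := Ideal.mem_span_singleton'.1 (by simpa using ha)
  refine ⟨W, ?_⟩
  have hD : MonoidAlgebra.mapRingHom (ZMod n)ˣ (PadicInt.Coe.ringHom (p := p))
      (∏ i ∈ d, ∑ j : Fin (N i), MonoidAlgebra.single (b i ^ (j : ℕ)) ((j : ℕ) : ℤ_[p])) =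
      ∏ i ∈ d, ∑ j : Fin (N i), MonoidAlgebra.single (b i ^ (j : ℕ)) ((j : ℕ) : ℚ_[p]) := by
    rw [mapRingHom_prod_sum_single_pow]
    simp_rw [map_natCast]
  have hpW : MonoidAlgebra.mapRingHom (ZMod n)ˣ (PadicInt.Coe.ringHom (p := p)) a =
      ((p : ℚ_[p]) ^ K) • MonoidAlgebra.mapRingHom (ZMod n)ˣ (PadicInt.Coe.ringHom (p := p)) W := by
    rw [← hW, map_mul, map_pow, map_natCast, Algebra.smul_def, map_pow, map_natCast, mul_comm]
  have key : (∏ i ∈ d, ∑ j : Fin (N i), MonoidAlgebra.single (b i ^ (j : ℕ)) ((j : ℕ) : ℚ_[p])) *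
      (MonoidAlgebra.mapRingHom (ZMod n)ˣ (algebraMap ℚ ℚ_[p]) Xp -
        MonoidAlgebra.mapRingHom (ZMod n)ˣ (PadicInt.Coe.ringHom (p := p)) Θ) =
      ((p : ℚ_[p]) ^ K) • MonoidAlgebra.mapRingHom (ZMod n)ˣ (PadicInt.Coe.ringHom (p := p)) W := by
    rw [← hpW]; exact hφa.symm
  rw [map_mul, hD, mul_comm (MonoidAlgebra.mapRingHom _ _ Θ), ← key]
  ring

/-! ### §2 The symmetrised avatar -/

set_option backward.isDefEq.respectTransparency false in
/-- **The scaled plus-projection of the avatar**: if `x = Σ_g X_g • σ_g ζ_n` (T-PKEV E-D) then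
`Σ_g (λ • (1 + δ₋₁)·X)_g • σ_g ζ_n = λ • (x + σ₋₁ x)` (E-E `ZetaValue.sigma_sum_coeff_smul_sigma`). [folklore] -/
theorem sum_coeff_smul_symm_smul_sigma_zeta (x : CyclotomicField n ℚ) (X : MonoidAlgebra ℚ (ZMod n)ˣ)
    (hxX : x = ∑ g : (ZMod n)ˣ, X.coeff g • sigma n g (IsCyclotomicExtension.zeta n ℚ (CyclotomicField n ℚ)))
    (c : ℚ) :
    ∑ g : (ZMod n)ˣ, (c • ((1 + MonoidAlgebra.single (-1 : (ZMod n)ˣ) (1 : ℚ)) * X)).coeff g •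
        sigma n g (IsCyclotomicExtension.zeta n ℚ (CyclotomicField n ℚ)) =
      c • (x + sigma n (-1) x) := by
  simp_rw [MonoidAlgebra.coeff_smul_apply, smul_eq_mul, mul_smul, ← Finset.smul_sum]
  congr 1
  rw [add_mul, one_mul]
  simp_rw [MonoidAlgebra.coeff_add, Finsupp.add_apply, add_smul, Finset.sum_add_distrib]
  rw [← ZetaValue.sigma_sum_coeff_smul_sigma, ← hxX]

/-! ### §3 ★★ The value witness from the comparison -/

/-- A natural number prime to `p` is a unit of `ℤ_p` (PK-4b-C's scalar `λ = n`). [folklore] -/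
theorem exists_units_coe_eq_natCast {m : ℕ} (hm : ¬ p ∣ m) :
    ∃ u : ℤ_[p]ˣ, ((u : ℤ_[p]) : ℚ_[p]) = (m : ℚ_[p]) := by
  have hu : IsUnit ((m : ℤ_[p])) := by
    rw [PadicInt.isUnit_iff, PadicInt.norm_def, PadicInt.coe_natCast, Padic.norm_natCast_eq_one_iff]
    exact (Nat.Prime.coprime_iff_not_dvd Fact.out).2 hm
  exact ⟨hu.unit, by rw [IsUnit.unit_spec, PadicInt.coe_natCast]⟩

omit [NeZero n] in
/-- The `ℤ_p`-action on `ℚ_p ⊗_ℚ ℚ(ζ_n)` on a pure tensor: `r • (a ⊗ w) = (r·a) ⊗ w`. [folklore] -/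
theorem padicInt_smul_tmul (r : ℤ_[p]) (a : ℚ_[p]) (w : CyclotomicField n ℚ) :
    r • (a ⊗ₜ[ℚ] w) = ((r : ℚ_[p]) * a) ⊗ₜ[ℚ] w := by
  rw [TensorProduct.smul_tmul', Algebra.smul_def, PadicInt.algebraMap_apply]

set_option backward.isDefEq.respectTransparency false in
/-- **★★ THE VALUE WITNESS FROM THE COMPARISON** (item (11) of `skel/T-PORT-1-PKIM.md`; the socket
of T-PK-PAR §5 / T-PK6-D58 (S3)).  Data: units `b_i ∈ (ℤ/n)ˣ`, lengths `N_i`, `i ∈ d` (THEOREM A3's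
derivative datum read through `χ_n`); `x ∈ ℚ(ζ_n)` with avatar `X` (`hxX`, T-PKEV E-D); a rational
`p`-adic unit `λ` (`u`, `hu`; PK-4b-C's `λ = n`); `p`-integral `Θ, W`; `c ∈ ℤ/p^{k+1}` with lift `c̃`;
`hXY` = the COMPARISON (PK-4b-C's OUT, E-C currency) `X⁺·∏D = (Θ·∏D)^ℚ + p^{k+1} • W^ℚ` for
`X⁺ = λ • (1 + δ₋₁)·X`; `hD` = PK-3's identity `Θ̄·∏D = c·∏Nrm` (+ §1's twist); `hnorm` = `∏Nrm = Σ_g δ_g`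
(E-A `prod_norm_eq_sum_single`).  Then with **`s := p^t · u⁻¹ · c̃ · μ(n)`**:
`∃ l ∈ L_int(n), p^t • (1 ⊗ 𝔇^{field}(x + σ₋₁ x)) − s ⊗ 1 = p^{k+1} • l` — TOKEN-FOR-TOKEN the `hval`
of `KatoParity.apply_localization_add_self_eq_toZModPow_of_zetaBody_deriv` (`n = cycLevel p 0 r`,
`x = x 0 r`, `b = χ_n ∘ σ`). [cite: Kim2022StructureSelmer, the proof of Thm. 3.13 (arXiv v3 pp. 26–28; = Thm. 3.11 of AJM 148)]
[cite: KimNakamura2020, Prop. 3.5 and Rem. 3.6 (arXiv v2 pp. 8–9)] -/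
theorem exists_mem_cycIntLattice_symm_deriv_sub_tmul_eq_pow_smul_of_comparison {ι : Type*}
    (d : Finset ι) (b : ι → (ZMod n)ˣ) (N : ι → ℕ)
    (x : CyclotomicField n ℚ) (X : MonoidAlgebra ℚ (ZMod n)ˣ)
    (hxX : x = ∑ g : (ZMod n)ˣ, X.coeff g • sigma n g (IsCyclotomicExtension.zeta n ℚ (CyclotomicField n ℚ)))
    (c₀ : ℚ) (u : ℤ_[p]ˣ) (hu : ((u : ℤ_[p]) : ℚ_[p]) = (c₀ : ℚ_[p]))
    (Θ W : MonoidAlgebra ℤ_[p] (ZMod n)ˣ) (k t : ℕ) (c : ZMod (p ^ (k + 1)))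
    (hXY : MonoidAlgebra.mapRingHom (ZMod n)ˣ (algebraMap ℚ ℚ_[p])
          (c₀ • ((1 + MonoidAlgebra.single (-1 : (ZMod n)ˣ) (1 : ℚ)) * X)) *
        ∏ i ∈ d, ∑ j : Fin (N i), MonoidAlgebra.single (b i ^ (j : ℕ)) ((j : ℕ) : ℚ_[p]) =
      MonoidAlgebra.mapRingHom (ZMod n)ˣ (PadicInt.Coe.ringHom (p := p))
          (Θ * ∏ i ∈ d, ∑ j : Fin (N i), MonoidAlgebra.single (b i ^ (j : ℕ)) ((j : ℕ) : ℤ_[p])) +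
        ((p : ℚ_[p]) ^ (k + 1)) • MonoidAlgebra.mapRingHom (ZMod n)ˣ (PadicInt.Coe.ringHom (p := p)) W)
    (hD : MonoidAlgebra.mapRingHom (ZMod n)ˣ (PadicInt.toZModPow (k + 1)) Θ *
        ∏ i ∈ d, ∑ j : Fin (N i), MonoidAlgebra.single (b i ^ (j : ℕ)) ((j : ℕ) : ZMod (p ^ (k + 1))) =
      c • ∏ i ∈ d, ∑ j : Fin (N i), MonoidAlgebra.single (b i ^ (j : ℕ)) (1 : ZMod (p ^ (k + 1))))
    (hnorm : ∏ i ∈ d, ∑ j : Fin (N i), MonoidAlgebra.single (b i ^ (j : ℕ)) (1 : ℤ_[p]) =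
      ∑ g : (ZMod n)ˣ, MonoidAlgebra.single g 1)
    (c' : ℤ_[p]) (hc : PadicInt.toZModPow (k + 1) c' = c)
    (comm : (d : Set ι).Pairwise fun i i' => Commute
      (∑ j ∈ Finset.range (N i), (j : Module.End ℚ (CyclotomicField n ℚ)) *
        (sigma n (b i) : CyclotomicField n ℚ →ₐ[ℚ] CyclotomicField n ℚ).toLinearMap ^ j)
      (∑ j ∈ Finset.range (N i'), (j : Module.End ℚ (CyclotomicField n ℚ)) *
        (sigma n (b i') : CyclotomicField n ℚ →ₐ[ℚ] CyclotomicField n ℚ).toLinearMap ^ j)) :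
    ∃ l ∈ cycIntLattice p n,
      ((p : ℤ_[p]) ^ t) • ((1 : ℚ_[p]) ⊗ₜ[ℚ] (d.noncommProd (fun i => ∑ j ∈ Finset.range (N i),
          (j : Module.End ℚ (CyclotomicField n ℚ)) *
            (sigma n (b i) : CyclotomicField n ℚ →ₐ[ℚ] CyclotomicField n ℚ).toLinearMap ^ j) comm
          (x + sigma n (-1) x))) -
        (((p : ℤ_[p]) ^ t * (↑u⁻¹ : ℤ_[p]) * c' * ((ArithmeticFunction.moebius n : ℤ) : ℤ_[p]) : ℤ_[p]) :
            ℚ_[p]) ⊗ₜ[ℚ] (1 : CyclotomicField n ℚ) =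
      ((p : ℤ_[p]) ^ (k + 1)) • l := by
  obtain ⟨l₁, hl₁, h₁⟩ :=
    exists_mem_cycIntLattice_one_tmul_deriv_sub_tmul_eq_pow_smul_of_comparison p n d b N
      (c₀ • ((1 + MonoidAlgebra.single (-1 : (ZMod n)ˣ) (1 : ℚ)) * X)) Θ W (k + 1) c hXY hD hnorm c'
      hc comm
  -- the argument of `𝔇^{field}` is `λ • (x + σ₋₁ x)`; pull `λ` out as the tensor factor `(λ : ℚ_p) ⊗ …`
  rw [sum_coeff_smul_symm_smul_sigma_zeta n x X hxX c₀, map_smul, ← TensorProduct.smul_tmul,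
    Rat.smul_one_eq_cast, ← hu] at h₁
  -- multiply by the `p`-adic integer `m = p^t · u⁻¹`
  refine ⟨((p : ℤ_[p]) ^ t * (↑u⁻¹ : ℤ_[p])) • l₁, Submodule.smul_mem _ _ hl₁, ?_⟩
  rw [padicInt_smul_tmul, mul_one, ← smul_comm, ← h₁, smul_sub, padicInt_smul_tmul, padicInt_smul_tmul]
  have e1 : (((p : ℤ_[p]) ^ t * (↑u⁻¹ : ℤ_[p]) : ℤ_[p]) : ℚ_[p]) * ((u : ℤ_[p]) : ℚ_[p]) =
      (((p : ℤ_[p]) ^ t : ℤ_[p]) : ℚ_[p]) := by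
    rw [PadicInt.coe_mul, mul_assoc, ← PadicInt.coe_mul, Units.inv_mul, PadicInt.coe_one, mul_one]
  have e2 : (((p : ℤ_[p]) ^ t * (↑u⁻¹ : ℤ_[p]) : ℤ_[p]) : ℚ_[p]) *
      ((c' : ℚ_[p]) * ((ArithmeticFunction.moebius n : ℤ) : ℚ_[p])) =
      (((p : ℤ_[p]) ^ t * (↑u⁻¹ : ℤ_[p]) * c' * ((ArithmeticFunction.moebius n : ℤ) : ℤ_[p]) : ℤ_[p]) :
        ℚ_[p]) := by
    push_cast
    ring
  rw [e1, e2]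

set_option backward.isDefEq.respectTransparency false in
/-- **★★ The value witness, MEMBERSHIP form of the comparison** (PK-4b-C3 `sum_mem_map_of_images`'s OUT
verbatim: `∏D · (X⁺ − Θ) ∈` the image of `p^{k+1}·ℤ_p[(ℤ/n)ˣ]`): §1's `exists_comparison_of_mem_map_span`
then ★★ above. [cite: Kim2022StructureSelmer, the proof of Thm. 3.13 (arXiv v3 pp. 26–28; = Thm. 3.11 of AJM 148)] -/
theorem exists_mem_cycIntLattice_symm_deriv_sub_tmul_eq_pow_smul_of_mem_map_span {ι : Type*}
    (d : Finset ι) (b : ι → (ZMod n)ˣ) (N : ι → ℕ)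
    (x : CyclotomicField n ℚ) (X : MonoidAlgebra ℚ (ZMod n)ˣ)
    (hxX : x = ∑ g : (ZMod n)ˣ, X.coeff g • sigma n g (IsCyclotomicExtension.zeta n ℚ (CyclotomicField n ℚ)))
    (c₀ : ℚ) (u : ℤ_[p]ˣ) (hu : ((u : ℤ_[p]) : ℚ_[p]) = (c₀ : ℚ_[p]))
    (Θ : MonoidAlgebra ℤ_[p] (ZMod n)ˣ) (k t : ℕ) (c : ZMod (p ^ (k + 1)))
    (hmem : (∏ i ∈ d, ∑ j : Fin (N i), MonoidAlgebra.single (b i ^ (j : ℕ)) ((j : ℕ) : ℚ_[p])) *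
        (MonoidAlgebra.mapRingHom (ZMod n)ˣ (algebraMap ℚ ℚ_[p])
            (c₀ • ((1 + MonoidAlgebra.single (-1 : (ZMod n)ˣ) (1 : ℚ)) * X)) -
          MonoidAlgebra.mapRingHom (ZMod n)ˣ (PadicInt.Coe.ringHom (p := p)) Θ) ∈
      (Ideal.span {((p : MonoidAlgebra ℤ_[p] (ZMod n)ˣ)) ^ (k + 1)}).toAddSubmonoid.map
        (MonoidAlgebra.mapRingHom (ZMod n)ˣ (PadicInt.Coe.ringHom (p := p)) :
          MonoidAlgebra ℤ_[p] (ZMod n)ˣ →+ MonoidAlgebra ℚ_[p] (ZMod n)ˣ))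
    (hD : MonoidAlgebra.mapRingHom (ZMod n)ˣ (PadicInt.toZModPow (k + 1)) Θ *
        ∏ i ∈ d, ∑ j : Fin (N i), MonoidAlgebra.single (b i ^ (j : ℕ)) ((j : ℕ) : ZMod (p ^ (k + 1))) =
      c • ∏ i ∈ d, ∑ j : Fin (N i), MonoidAlgebra.single (b i ^ (j : ℕ)) (1 : ZMod (p ^ (k + 1))))
    (hnorm : ∏ i ∈ d, ∑ j : Fin (N i), MonoidAlgebra.single (b i ^ (j : ℕ)) (1 : ℤ_[p]) =
      ∑ g : (ZMod n)ˣ, MonoidAlgebra.single g 1)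
    (c' : ℤ_[p]) (hc : PadicInt.toZModPow (k + 1) c' = c)
    (comm : (d : Set ι).Pairwise fun i i' => Commute
      (∑ j ∈ Finset.range (N i), (j : Module.End ℚ (CyclotomicField n ℚ)) *
        (sigma n (b i) : CyclotomicField n ℚ →ₐ[ℚ] CyclotomicField n ℚ).toLinearMap ^ j)
      (∑ j ∈ Finset.range (N i'), (j : Module.End ℚ (CyclotomicField n ℚ)) *
        (sigma n (b i') : CyclotomicField n ℚ →ₐ[ℚ] CyclotomicField n ℚ).toLinearMap ^ j)) :
    ∃ l ∈ cycIntLattice p n,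
      ((p : ℤ_[p]) ^ t) • ((1 : ℚ_[p]) ⊗ₜ[ℚ] (d.noncommProd (fun i => ∑ j ∈ Finset.range (N i),
          (j : Module.End ℚ (CyclotomicField n ℚ)) *
            (sigma n (b i) : CyclotomicField n ℚ →ₐ[ℚ] CyclotomicField n ℚ).toLinearMap ^ j) comm
          (x + sigma n (-1) x))) -
        (((p : ℤ_[p]) ^ t * (↑u⁻¹ : ℤ_[p]) * c' * ((ArithmeticFunction.moebius n : ℤ) : ℤ_[p]) : ℤ_[p]) :
            ℚ_[p]) ⊗ₜ[ℚ] (1 : CyclotomicField n ℚ) =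
      ((p : ℤ_[p]) ^ (k + 1)) • l := by
  obtain ⟨W, hXY⟩ := exists_comparison_of_mem_map_span p n d b N _ Θ (k + 1) hmem
  exact exists_mem_cycIntLattice_symm_deriv_sub_tmul_eq_pow_smul_of_comparison p n d b N x X hxX c₀ u hu
    Θ W k t c hXY hD hnorm c' hc comm

/-! ### §4 The unit reading `s ≡ w · p^t · δ̃_n` -/

/-- **`(−1)^{ν(n)} · μ(n) = 1` for square-free `n`** (`ν(n) = #n.primeFactors`): PK-3's sign against
the Ramanujan sum of the norm element. [folklore] -/
theorem neg_one_pow_card_primeFactors_mul_moebius {S : Type*} [CommRing S] (hn : Squarefree n) :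
    (-1 : S) ^ n.primeFactors.card * ((ArithmeticFunction.moebius n : ℤ) : S) = 1 := by
  have hμ : ArithmeticFunction.moebius n = (-1) ^ n.primeFactors.card := by
    rw [ArithmeticFunction.moebius_apply_of_squarefree hn,
      ← (ArithmeticFunction.cardDistinctFactors_eq_cardFactors_iff_squarefree (NeZero.ne n)).2 hn,
      ArithmeticFunction.cardDistinctFactors_apply, ← List.card_toFinset, Nat.primeFactors]
  rw [hμ, Int.cast_pow, Int.cast_neg, Int.cast_one, ← pow_add, ← two_mul, pow_mul, neg_one_sq, one_pow]

/-- **The unit reading of the witness.**  If PK-3's scalar is `c = ((−1)^{ν(n)} · δ) · a`, `a` a unit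
(the augmentation of the twist `V̄`, §1), `c̃` lifts `c` and `n` is square-free, then
`\overline{p^t · u⁻¹ · c̃ · μ(n)} = w · p^t · δ` with the unit `w = ū⁻¹ · a` — DICT3's shape `u_d · 3^t · δ̃`.
[cite: Kim2022StructureSelmer, Thm. 3.13 (arXiv p. 17)] -/
theorem exists_units_toZModPow_witness_eq (hn : Squarefree n) (k t : ℕ) (u : ℤ_[p]ˣ) (c' : ℤ_[p])
    (δ : ZMod (p ^ (k + 1))) (a : (ZMod (p ^ (k + 1)))ˣ)
    (hc : PadicInt.toZModPow (k + 1) c' = (-1 : ZMod (p ^ (k + 1))) ^ n.primeFactors.card * δ * a) :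
    ∃ w : (ZMod (p ^ (k + 1)))ˣ,
      PadicInt.toZModPow (k + 1)
          ((p : ℤ_[p]) ^ t * (↑u⁻¹ : ℤ_[p]) * c' * ((ArithmeticFunction.moebius n : ℤ) : ℤ_[p])) =
        (w : ZMod (p ^ (k + 1))) * (p : ZMod (p ^ (k + 1))) ^ t * δ := by
  refine ⟨(Units.map (PadicInt.toZModPow (p := p) (k + 1)).toMonoidHom u)⁻¹ * a, ?_⟩
  have hinv : (((Units.map (PadicInt.toZModPow (p := p) (k + 1)).toMonoidHom u)⁻¹ : (ZMod (p ^ (k + 1)))ˣ) :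
      ZMod (p ^ (k + 1))) = PadicInt.toZModPow (k + 1) (↑u⁻¹ : ℤ_[p]) := by
    rw [Units.coe_map_inv]
    rfl
  rw [Units.val_mul, hinv, map_mul, map_mul, map_mul, map_pow, map_natCast, map_intCast, hc]
  have h1 := neg_one_pow_card_primeFactors_mul_moebius n (S := ZMod (p ^ (k + 1))) hn
  linear_combination ((p : ZMod (p ^ (k + 1))) ^ t * PadicInt.toZModPow (k + 1) (↑u⁻¹ : ℤ_[p]) * δ * a) * h1

set_option backward.isDefEq.respectTransparency false in
/-- **★ The value law shape at level `n`**: under §3's hypotheses, PK-3's scalar form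
`c = (−1)^{ν(n)} δ · a` (`a` a unit) and `n` square-free, the witness `s` of §3 satisfies BOTH the
`hval` premise and `s̄ = w · p^t · δ` for a unit `w` — the two conjuncts of item (11).
[cite: Kim2022StructureSelmer, Thm. 3.13 and its proof (arXiv v3 pp. 17, 26–28)] -/
theorem exists_witness_hval_and_toZModPow_eq {ι : Type*} (hn : Squarefree n)
    (d : Finset ι) (b : ι → (ZMod n)ˣ) (N : ι → ℕ)
    (x : CyclotomicField n ℚ) (X : MonoidAlgebra ℚ (ZMod n)ˣ)
    (hxX : x = ∑ g : (ZMod n)ˣ, X.coeff g • sigma n g (IsCyclotomicExtension.zeta n ℚ (CyclotomicField n ℚ)))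
    (c₀ : ℚ) (u : ℤ_[p]ˣ) (hu : ((u : ℤ_[p]) : ℚ_[p]) = (c₀ : ℚ_[p]))
    (Θ W : MonoidAlgebra ℤ_[p] (ZMod n)ˣ) (k t : ℕ) (δ : ZMod (p ^ (k + 1))) (a : (ZMod (p ^ (k + 1)))ˣ)
    (hXY : MonoidAlgebra.mapRingHom (ZMod n)ˣ (algebraMap ℚ ℚ_[p])
          (c₀ • ((1 + MonoidAlgebra.single (-1 : (ZMod n)ˣ) (1 : ℚ)) * X)) *
        ∏ i ∈ d, ∑ j : Fin (N i), MonoidAlgebra.single (b i ^ (j : ℕ)) ((j : ℕ) : ℚ_[p]) =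
      MonoidAlgebra.mapRingHom (ZMod n)ˣ (PadicInt.Coe.ringHom (p := p))
          (Θ * ∏ i ∈ d, ∑ j : Fin (N i), MonoidAlgebra.single (b i ^ (j : ℕ)) ((j : ℕ) : ℤ_[p])) +
        ((p : ℚ_[p]) ^ (k + 1)) • MonoidAlgebra.mapRingHom (ZMod n)ˣ (PadicInt.Coe.ringHom (p := p)) W)
    (hD : MonoidAlgebra.mapRingHom (ZMod n)ˣ (PadicInt.toZModPow (k + 1)) Θ *
        ∏ i ∈ d, ∑ j : Fin (N i), MonoidAlgebra.single (b i ^ (j : ℕ)) ((j : ℕ) : ZMod (p ^ (k + 1))) =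
      ((-1 : ZMod (p ^ (k + 1))) ^ n.primeFactors.card * δ * a) •
        ∏ i ∈ d, ∑ j : Fin (N i), MonoidAlgebra.single (b i ^ (j : ℕ)) (1 : ZMod (p ^ (k + 1))))
    (hnorm : ∏ i ∈ d, ∑ j : Fin (N i), MonoidAlgebra.single (b i ^ (j : ℕ)) (1 : ℤ_[p]) =
      ∑ g : (ZMod n)ˣ, MonoidAlgebra.single g 1)
    (comm : (d : Set ι).Pairwise fun i i' => Commute
      (∑ j ∈ Finset.range (N i), (j : Module.End ℚ (CyclotomicField n ℚ)) *
        (sigma n (b i) : CyclotomicField n ℚ →ₐ[ℚ] CyclotomicField n ℚ).toLinearMap ^ j)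
      (∑ j ∈ Finset.range (N i'), (j : Module.End ℚ (CyclotomicField n ℚ)) *
        (sigma n (b i') : CyclotomicField n ℚ →ₐ[ℚ] CyclotomicField n ℚ).toLinearMap ^ j)) :
    ∃ s : ℤ_[p],
      (∃ l ∈ cycIntLattice p n,
        ((p : ℤ_[p]) ^ t) • ((1 : ℚ_[p]) ⊗ₜ[ℚ] (d.noncommProd (fun i => ∑ j ∈ Finset.range (N i),
            (j : Module.End ℚ (CyclotomicField n ℚ)) *
              (sigma n (b i) : CyclotomicField n ℚ →ₐ[ℚ] CyclotomicField n ℚ).toLinearMap ^ j) comm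
            (x + sigma n (-1) x))) -
          (s : ℚ_[p]) ⊗ₜ[ℚ] (1 : CyclotomicField n ℚ) =
        ((p : ℤ_[p]) ^ (k + 1)) • l) ∧
      ∃ w : (ZMod (p ^ (k + 1)))ˣ,
        PadicInt.toZModPow (k + 1) s = (w : ZMod (p ^ (k + 1))) * (p : ZMod (p ^ (k + 1))) ^ t * δ := by
  haveI : NeZero (p ^ (k + 1)) := ⟨pow_ne_zero _ (Fact.out : p.Prime).ne_zero⟩
  -- a lift of PK-3's scalar
  set c : ZMod (p ^ (k + 1)) := (-1 : ZMod (p ^ (k + 1))) ^ n.primeFactors.card * δ * a with hcdef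
  obtain ⟨l, hl, h⟩ := exists_mem_cycIntLattice_symm_deriv_sub_tmul_eq_pow_smul_of_comparison p n d b N
    x X hxX c₀ u hu Θ W k t c hXY hD hnorm ((c.val : ℕ) : ℤ_[p])
    (by rw [map_natCast, ZMod.natCast_zmod_val]) comm
  obtain ⟨w, hw⟩ := exists_units_toZModPow_witness_eq p n hn k t u ((c.val : ℕ) : ℤ_[p]) δ a
    (by rw [map_natCast, ZMod.natCast_zmod_val])
  exact ⟨_, ⟨l, hl, h⟩, w, hw⟩

end GroupRingEval

end Summit.BirchSwinnertonDyer.Rank1Residual.GaloisImage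

end
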